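import Summits.PneNP.PneNP.Theorems.KrwChromaticSteeringStrongCompositionLradDefs
import Literature.Computability.Complexity.KWDepthHardFunctions

/-!
# Crux line `lrad-gluing` (stmt-PneNP-18538), support statement S0: one `g` both KW-hard and affine-generic

`jointHardGeneric_exists` (verbatim from the closed skeleton `Cruxes/StrongComposition/Lines/lrad_gluing.lean`
§6, commit 5a5f8789ebd3): for every `n ≥ 1` ONE non-constant `g : {0,1}^n → {0,1}` that is
`2 (log₂ n + 1)`-affine-generic AND has Karchmer–Wigderson depth `≥ n − 8 (log₂ n + 1)`, by adding two counts:
`#Code(n,S) < 2^{2^{n−1}}` easy functions (Riordan–Shannon, `CircuitCount.card_code_le`) and `≤ 2^{2^n − 1}`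
affine-degenerate ones (`exists_affBad`); small `n ≤ 8` by a dictator.  FRONTIER rung; nothing on P vs NP.
-/

set_option linter.dupNamespace false -- `Summit.PneNP.PneNP.…`: summit = sub-problem name (D-0017 single-conjunct layout)
set_option autoImplicit false

namespace Summit.PneNP.PneNP.Theorems.KrwLrad

open Literature.Computability.Complexity Literature.Computability.MetaComplexity

section JointExistence
variable {n : ℕ}

/-- Parity on `insert j S` splits off the entry `x j`. -/
theorem rowParity_insert {S : Finset (Fin n)} {j : Fin n} (h : j ∉ S) (x : Fin n → Bool) :
    rowParity (insert j S) x = Bool.xor (x j) (rowParity S x) := by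
  unfold rowParity
  rw [Finset.filter_insert]
  by_cases hx : x j = true
  · rw [if_pos hx, Finset.card_insert_of_notMem (by simp [Finset.mem_filter, h]), Nat.bodd_add, hx]
    cases Nat.bodd (S.filter fun j => x j = true).card <;> rfl
  · rw [if_neg hx]
    simp only [Bool.not_eq_true] at hx
    rw [hx]
    cases Nat.bodd (S.filter fun j => x j = true).card <;> rfl

/-- Parity of a pointwise xor of two vectors. -/
theorem rowParity_bxor (S : Finset (Fin n)) (x y : Fin n → Bool) :
    rowParity S (fun j => Bool.xor (x j) (y j)) = Bool.xor (rowParity S x) (rowParity S y) := by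
  induction S using Finset.induction_on with
  | empty => simp [rowParity]
  | insert j S hj ih =>
    rw [rowParity_insert hj, rowParity_insert hj, rowParity_insert hj, ih]
    cases x j <;> cases y j <;> cases rowParity S x <;> cases rowParity S y <;> rfl

/-- A satisfiable system of `k` parity equations on `{0,1}^n` has at least `2^{n-k}` solutions. -/
theorem two_pow_le_card_sol (E : List (Finset (Fin n) × Bool))
    (hsat : ∃ x, ∀ e ∈ E, rowParity e.1 x = e.2) :
    2 ^ (n - E.length) ≤
      (Finset.univ.filter fun x : Fin n → Bool => ∀ e ∈ E, rowParity e.1 x = e.2).card := by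
  induction E with
  | nil => simp
  | cons e E ih =>
    obtain ⟨x₀, hx₀⟩ := hsat
    have hx₀E : ∀ e' ∈ E, rowParity e'.1 x₀ = e'.2 := fun e' he' => hx₀ e' (List.mem_cons_of_mem _ he')
    have hx₀e : rowParity e.1 x₀ = e.2 := hx₀ e List.mem_cons_self
    have ih' := ih ⟨x₀, hx₀E⟩
    set T := Finset.univ.filter (fun x : Fin n → Bool => ∀ e' ∈ E, rowParity e'.1 x = e'.2) with hT
    have hT1eq : (Finset.univ.filter fun x : Fin n → Bool => ∀ e' ∈ e :: E, rowParity e'.1 x = e'.2)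
        = T.filter fun x => rowParity e.1 x = e.2 := by
      ext x
      simp only [Finset.mem_filter, Finset.mem_univ, true_and, List.forall_mem_cons, hT]
      exact and_comm
    rw [hT1eq]
    have hsplit := Finset.card_filter_add_card_filter_not
      (s := T) (fun x => rowParity e.1 x = e.2)
    have hle : (T.filter fun x => ¬ rowParity e.1 x = e.2).card
        ≤ (T.filter fun x => rowParity e.1 x = e.2).card := by
      by_cases h0 : (T.filter fun x => ¬ rowParity e.1 x = e.2) = ∅
      · rw [h0]; simp
      · obtain ⟨x₁, hx₁⟩ := Finset.nonempty_iff_ne_empty.mpr h0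
        simp only [Finset.mem_filter, hT, Finset.mem_univ, true_and] at hx₁
        apply Finset.card_le_card_of_injOn
          (fun x : Fin n → Bool => fun j => Bool.xor (Bool.xor (x j) (x₀ j)) (x₁ j))
        · intro x hx
          simp only [Finset.coe_filter, Finset.mem_filter, Finset.mem_univ, true_and, hT,
            Set.mem_setOf_eq] at hx ⊢
          refine ⟨fun e' he' => ?_, ?_⟩
          · rw [rowParity_bxor e'.1 (fun j => Bool.xor (x j) (x₀ j)) x₁, rowParity_bxor,
              hx.1 e' he', hx₀E e' he', hx₁.1 e' he']
            cases e'.2 <;> rfl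
          · rw [rowParity_bxor e.1 (fun j => Bool.xor (x j) (x₀ j)) x₁, rowParity_bxor, hx₀e]
            have h1 := hx.2
            have h2 := hx₁.2
            revert h1 h2
            cases rowParity e.1 x <;> cases rowParity e.1 x₁ <;> cases e.2 <;> simp
        · intro x _ x' _ h
          funext j
          have := congr_fun h j
          simp only at this
          revert this
          cases x j <;> cases x' j <;> cases x₀ j <;> cases x₁ j <;> simp
    have h1 : 1 ≤ (T.filter fun x => rowParity e.1 x = e.2).card := by
      apply Finset.card_pos.mpr
      refine ⟨x₀, ?_⟩
      rw [Finset.mem_filter, hT]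
      exact ⟨by simp only [Finset.mem_filter, Finset.mem_univ, true_and]; exact hx₀E, hx₀e⟩
    rcases Nat.eq_zero_or_pos (n - E.length) with hz | hpos
    · have : n - (e :: E).length = 0 := by simp only [List.length_cons]; omega
      rw [this]; simpa using h1
    · have heq : n - E.length = (n - (e :: E).length) + 1 := by simp only [List.length_cons]; omega
      rw [heq, pow_succ] at ih'
      omega

/-- Boolean functions on `{0,1}^n` that are constant `= b` on `T` number at most `2^{2^n − |T|}`. -/
theorem card_const_on_le (T : Finset (Fin n → Bool)) (b : Bool) :
    (Finset.univ.filter fun g : (Fin n → Bool) → Bool => ∀ x ∈ T, g x = b).card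
      ≤ 2 ^ (2 ^ n - T.card) := by
  have hc : Fintype.card ({x : Fin n → Bool // x ∉ T} → Bool) = 2 ^ (2 ^ n - T.card) := by
    rw [Fintype.card_fun, Fintype.card_bool, Fintype.card_subtype_compl, Fintype.card_coe]
    simp [Fintype.card_bool, Fintype.card_fin]
  rw [← hc, ← Finset.card_univ]
  apply Finset.card_le_card_of_injOn (fun g => fun x : {x : Fin n → Bool // x ∉ T} => g x.1)
  · intro g _; simp
  · intro g hg g' hg' h
    simp only [Finset.coe_filter, Finset.mem_univ, true_and, Set.mem_setOf_eq] at hg hg'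
    funext x
    by_cases hx : x ∈ T
    · rw [hg x hx, hg' x hx]
    · exact congr_fun h ⟨x, hx⟩

/-- The affine-degenerate functions are at most HALF of all functions (g18's STUB-2 count, sharpened by
one bit): outside a set of `≤ 2^{2^n − 1}` functions every `g` is `2 (log₂ n + 1)`-generic. -/
theorem exists_affBad (hrn : 2 * (Nat.log 2 n + 1) + 1 ≤ n) :
    ∃ Bad : Finset ((Fin n → Bool) → Bool), Bad.card ≤ 2 ^ (2 ^ n - 1) ∧
      ∀ g, g ∉ Bad → AffGeneric g (2 * (Nat.log 2 n + 1)) := by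
  classical
  set L := Nat.log 2 n with hL
  set r := 2 * (L + 1) with hr
  set N := n - r - 1 with hN
  have hNr : n - N = r + 1 := by omega
  -- the bad set
  set SatR : List (Finset (Fin n) × Bool) → (Fin n → Bool) → Prop :=
    fun E x => ∀ e ∈ E, rowParity e.1 x = e.2 with hSatR
  set Piece : (Fin N → Finset (Fin n) × Bool) → Bool → Finset ((Fin n → Bool) → Bool) :=
    fun σ b => Finset.univ.filter fun g =>
      (∃ x, SatR (List.ofFn σ) x) ∧ ∀ x, SatR (List.ofFn σ) x → g x = b with hPiece
  set Bad : Finset ((Fin n → Bool) → Bool) :=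
    (Finset.univ : Finset (Fin N → Finset (Fin n) × Bool)).biUnion fun σ =>
      (Finset.univ : Finset Bool).biUnion fun b => Piece σ b with hBad
  -- each piece is small
  have hterm : ∀ (σ : Fin N → Finset (Fin n) × Bool) (b : Bool),
      (Piece σ b).card ≤ 2 ^ (2 ^ n - 2 ^ (r + 1)) := by
    intro σ b
    by_cases hσ : ∃ x, SatR (List.ofFn σ) x
    · set T := Finset.univ.filter (fun x => SatR (List.ofFn σ) x) with hT
      have hTc : 2 ^ (n - (List.ofFn σ).length) ≤ T.card := two_pow_le_card_sol _ hσ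
      rw [List.length_ofFn, hNr] at hTc
      calc (Piece σ b).card
          ≤ (Finset.univ.filter fun g : (Fin n → Bool) → Bool => ∀ x ∈ T, g x = b).card := by
            apply Finset.card_le_card
            intro g hg
            simp only [hPiece, Finset.mem_filter, Finset.mem_univ, true_and, hT] at hg ⊢
            intro x hx
            exact hg.2 x hx
        _ ≤ 2 ^ (2 ^ n - T.card) := card_const_on_le T b
        _ ≤ 2 ^ (2 ^ n - 2 ^ (r + 1)) := Nat.pow_le_pow_right (by norm_num) (by omega)
    · have : Piece σ b = ∅ := by
        rw [hPiece]
        apply Finset.filter_eq_empty_iff.mpr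
        intro g _ h
        exact hσ h.1
      rw [this]; simp
  -- the bad set is not everything
  have hlog : n < 2 ^ (L + 1) := Nat.lt_pow_succ_log_self one_lt_two n
  have hcardσ : Fintype.card (Fin N → Finset (Fin n) × Bool) = 2 ^ ((n + 1) * N) := by
    rw [Fintype.card_fun, Fintype.card_prod, Fintype.card_finset, Fintype.card_bool,
      Fintype.card_fin, Fintype.card_fin, ← pow_succ, ← pow_mul]
  have hexp : (n + 1) * N + 1 < 2 ^ (r + 1) := by
    have hN3 : N + 3 ≤ n := by omega
    have h1 : (n + 1) * N + 2 ≤ n * n := by nlinarith [Nat.mul_le_mul_left (n + 1) hN3]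
    have h2 : n * n < 2 ^ (L + 1) * 2 ^ (L + 1) := Nat.mul_lt_mul'' hlog hlog
    have h3 : 2 ^ (L + 1) * 2 ^ (L + 1) ≤ 2 ^ (r + 1) := by
      rw [← pow_add]; exact Nat.pow_le_pow_right (by norm_num) (by omega)
    exact lt_of_lt_of_le (lt_of_lt_of_le (Nat.lt_succ_of_le le_rfl) h1) (le_trans h2.le h3) |>.trans_le le_rfl
  have hpow : 2 ^ (r + 1) ≤ 2 ^ n := Nat.pow_le_pow_right (by norm_num) hrn
  have hA : 2 ^ (2 ^ n) = 2 ^ (2 ^ (r + 1)) * 2 ^ (2 ^ n - 2 ^ (r + 1)) := by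
    rw [← pow_add]; congr 1; omega
  have hone : 1 ≤ 2 ^ (r + 1) := Nat.one_le_two_pow
  have hBadle : Bad.card ≤ 2 ^ (2 ^ n - 1) := by
    calc Bad.card ≤ ∑ σ : Fin N → Finset (Fin n) × Bool, ∑ b : Bool, (Piece σ b).card := by
            refine Finset.card_biUnion_le.trans ?_
            apply Finset.sum_le_sum; intro σ _; exact Finset.card_biUnion_le
      _ ≤ ∑ σ : Fin N → Finset (Fin n) × Bool, ∑ b : Bool, 2 ^ (2 ^ n - 2 ^ (r + 1)) := by
            apply Finset.sum_le_sum; intro σ _; apply Finset.sum_le_sum; intro b _; exact hterm σ b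
      _ = 2 ^ ((n + 1) * N) * (2 * 2 ^ (2 ^ n - 2 ^ (r + 1))) := by
            simp only [Finset.sum_const, Finset.card_univ, hcardσ, Fintype.card_bool, smul_eq_mul]
      _ = 2 ^ ((n + 1) * N + 1) * 2 ^ (2 ^ n - 2 ^ (r + 1)) := by ring
      _ ≤ 2 ^ (2 ^ (r + 1) - 1) * 2 ^ (2 ^ n - 2 ^ (r + 1)) :=
            Nat.mul_le_mul_right _ (Nat.pow_le_pow_right (by norm_num) (by omega))
      _ = 2 ^ (2 ^ n - 1) := by rw [← pow_add]; congr 1; omega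
  refine ⟨Bad, hBadle, fun g hg => ?_⟩
  intro E hE hsat β
  by_contra hc
  push Not at hc
  apply hg
  -- pad `E` to length `N`
  let σ : Fin N → Finset (Fin n) × Bool :=
    fun t => if h : t.val < E.length then E[t.val] else (∅, false)
  have hiff : ∀ x, SatR (List.ofFn σ) x ↔ ∀ e ∈ E, rowParity e.1 x = e.2 := by
    intro x
    simp only [hSatR]
    constructor
    · intro h e he
      obtain ⟨i, hi, rfl⟩ := List.mem_iff_getElem.1 he
      have ht : (⟨i, by omega⟩ : Fin N).val < E.length := hi
      have := h (σ ⟨i, by omega⟩) (List.mem_ofFn.2 ⟨_, rfl⟩)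
      simp only [σ, dif_pos hi] at this
      exact this
    · intro h e' he'
      obtain ⟨t, rfl⟩ := List.mem_ofFn.1 he'
      by_cases ht : t.val < E.length
      · simp only [σ, dif_pos ht]
        exact h _ (List.getElem_mem ht)
      · simp [σ, dif_neg ht, rowParity]
  simp only [hBad, Finset.mem_biUnion, Finset.mem_univ, true_and]
  refine ⟨σ, !β, ?_⟩
  simp only [hPiece, Finset.mem_filter, Finset.mem_univ, true_and]
  refine ⟨?_, fun x hx => ?_⟩
  · obtain ⟨x, hx⟩ := hsat
    exact ⟨x, (hiff x).2 hx⟩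
  · have := hc x ((hiff x).1 hx)
    revert this
    cases g x <;> cases β <;> simp

/-- Functions of `B₂`-circuit complexity `≤ S` are decodings of codes: at most `#Code(n,S)` of them. -/
theorem card_easy_le_card_code (n S : ℕ) :
    (Finset.univ.filter fun g : (Fin n → Bool) → Bool => circuitSizeOver B2 g ≤ S).card
      ≤ Fintype.card (CircuitCount.Code n S) := by
  classical
  calc (Finset.univ.filter fun g : (Fin n → Bool) → Bool => circuitSizeOver B2 g ≤ S).card
      ≤ (Finset.univ.image fun c : CircuitCount.Code n S => CircuitCount.decode c).card := by
        apply Finset.card_le_card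
        intro g hg
        simp only [Finset.mem_filter, Finset.mem_univ, true_and] at hg
        obtain ⟨C, hB, hC, hsize⟩ := exists_computes_B2_size_eq_holds g
        obtain ⟨c, hc⟩ := CircuitCount.exists_code C hB (hsize ▸ hg)
        refine Finset.mem_image.2 ⟨c, Finset.mem_univ _, ?_⟩
        rw [hc]; funext x; exact hC x
    _ ≤ Fintype.card (CircuitCount.Code n S) := Finset.card_image_le.trans (by rw [Finset.card_univ])

/-- `⌊log₂ n⌋ + 6 ≤ n` for `n ≥ 9` (the tree's private `log_two_add_six_le`, restated). -/
theorem log_two_add_six_le {n : ℕ} (hn : 9 ≤ n) : Nat.log 2 n + 6 ≤ n := by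
  have key : ∀ m : ℕ, 9 + m < 2 ^ (m + 4) := by
    intro m
    induction m with
    | zero => norm_num
    | succ m ih => rw [pow_succ]; omega
  obtain ⟨m, rfl⟩ : ∃ m, n = 9 + m := ⟨n - 9, by omega⟩
  have hlt : Nat.log 2 (9 + m) < m + 4 := Nat.log_lt_of_lt_pow (by omega) (key m)
  omega

/-- **Riordan–Shannon, one exponent sharper than the tree states it**: for `n ≥ 9` and
`S + 2 = 2^{n − ⌊log₂ n⌋ − 4}`, `#Code(n,S) < 2^{2^{n−1}}` (same proof as
`card_code_lt_two_pow_two_pow`, which discards the last factor of two). -/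
theorem card_code_lt_two_pow_two_pow_pred {n S : ℕ} (hn : 9 ≤ n)
    (hS : S + 2 = 2 ^ (n - (Nat.log 2 n + 4))) :
    Fintype.card (CircuitCount.Code n S) < 2 ^ 2 ^ (n - 1) := by
  set t := Nat.log 2 n + 4 with ht
  have htn : t + 2 ≤ n := by have := log_two_add_six_le hn; omega
  set M := n + S + 1 with hM
  have h16 : (S + 1) * M ≤ 16 * M ^ 2 := by nlinarith
  have hcard : Fintype.card (CircuitCount.Code n S) ≤ (16 * M ^ 2) ^ (S + 1) := by
    calc Fintype.card (CircuitCount.Code n S)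
        ≤ (S + 1) * (16 * M ^ 2) ^ S * M := CircuitCount.card_code_le n S
      _ = (16 * M ^ 2) ^ S * ((S + 1) * M) := by ring
      _ ≤ (16 * M ^ 2) ^ S * (16 * M ^ 2) := Nat.mul_le_mul_left _ h16
      _ = (16 * M ^ 2) ^ (S + 1) := by ring
  have hS1 : S + 2 ≤ 2 ^ (n - 1) := by
    rw [hS]; exact Nat.pow_le_pow_right (by norm_num) (by omega)
  have hMle : M ≤ 2 ^ n := by
    have h2 : 2 ^ n = 2 * 2 ^ (n - 1) := by
      rw [← pow_succ']; congr 1; omega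
    have hn1 : n ≤ 2 ^ (n - 1) := by
      have := Nat.lt_two_pow_self (n := n - 1)
      omega
    omega
  have h16M : 16 * M ^ 2 ≤ 2 ^ (2 * n + 4) := by
    have : 2 ^ (2 * n + 4) = 16 * (2 ^ n) ^ 2 := by ring
    rw [this]
    gcongr
  have hlog : n < 2 ^ (Nat.log 2 n + 1) := Nat.lt_pow_succ_log_self (by norm_num) n
  have h2n4 : 2 * n + 4 ≤ 2 ^ (t - 1) := by
    have : 2 ^ (t - 1) = 4 * 2 ^ (Nat.log 2 n + 1) := by
      rw [ht, show Nat.log 2 n + 4 - 1 = (Nat.log 2 n + 1) + 2 by omega, pow_add]; ring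
    omega
  have hexp : (2 * n + 4) * (S + 1) < 2 ^ (n - 1) := by
    have hS' : S + 1 < 2 ^ (n - t) := by omega
    calc (2 * n + 4) * (S + 1) ≤ 2 ^ (t - 1) * (S + 1) := Nat.mul_le_mul_right _ h2n4
      _ < 2 ^ (t - 1) * 2 ^ (n - t) := Nat.mul_lt_mul_of_pos_left hS' (by positivity)
      _ = 2 ^ (n - 1) := by rw [← pow_add]; congr 1; omega
  calc Fintype.card (CircuitCount.Code n S) ≤ (16 * M ^ 2) ^ (S + 1) := hcard
    _ ≤ (2 ^ (2 * n + 4)) ^ (S + 1) := Nat.pow_le_pow_left h16M _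
    _ = 2 ^ ((2 * n + 4) * (S + 1)) := by rw [← pow_mul]
    _ < 2 ^ 2 ^ (n - 1) := Nat.pow_lt_pow_right (by norm_num) hexp

/-- `2L + 3 ≤ 2^L` for `L ≥ 4`. -/
theorem two_mul_add_three_le_two_pow {L : ℕ} (h : 4 ≤ L) : 2 * L + 3 ≤ 2 ^ L := by
  induction L, h using Nat.le_induction with
  | base => norm_num
  | succ L hL ih =>
    have : 1 ≤ 2 ^ L := Nat.one_le_two_pow
    rw [pow_succ]; omega

/-- **S0 holds**: for every `n ≥ 1` there is a non-constant `g : {0,1}^n → {0,1}` which is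
`2 (log₂ n + 1)`-affine-generic (`AffGeneric`, L⁺'s hypothesis) AND whose Karchmer–Wigderson game has
protocol depth `≥ n − 8 (log₂ n + 1)` (M3's hypothesis) — the joint inner function the LRAD adversary needs. -/
theorem jointHardGeneric_exists : ∃ c : ℕ, ∀ n : ℕ, 1 ≤ n → ∃ g : (Fin n → Bool) → Bool,
    (∃ u v, g u = true ∧ g v = false) ∧ AffGeneric g (2 * (Nat.log 2 n + 1)) ∧
    ∀ P : Literature.Computability.Complexity.KWTree (Fin n), P.Solves g →
      n ≤ P.depth + c * (Nat.log 2 n + 1) := by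
  classical
  refine ⟨8, fun n hn => ?_⟩
  have hlog : n < 2 ^ (Nat.log 2 n + 1) := Nat.lt_pow_succ_log_self one_lt_two n
  by_cases hsmall : n ≤ 8
  · -- small `n`: a dictator; genericity only has to handle the empty system
    have hL : n ≤ 2 * Nat.log 2 n + 3 := by
      rcases Nat.lt_or_ge (Nat.log 2 n) 3 with h3 | h3
      · generalize hLn : Nat.log 2 n = L at hlog h3 ⊢
        interval_cases L <;> simp at hlog <;> omega
      · omega
    refine ⟨fun x => x ⟨0, by omega⟩, ⟨fun _ => true, fun _ => false, rfl, rfl⟩, ?_, ?_⟩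
    · intro E hE hsat β
      have hE0 : E = [] := List.eq_nil_of_length_eq_zero (by omega)
      subst hE0
      exact ⟨fun _ => β, fun e he => by simp at he, rfl⟩
    · intro P _
      have := Nat.zero_le P.depth
      nlinarith [Nat.zero_le (Nat.log 2 n)]
  have hn9 : 9 ≤ n := by omega
  set L := Nat.log 2 n with hLdef
  have hL3 : 3 ≤ L := by
    by_contra h
    have : 2 ^ (L + 1) ≤ 2 ^ 3 := Nat.pow_le_pow_right (by norm_num) (by omega)
    omega
  have hpowL : 2 ^ L ≤ n := by rw [hLdef]; exact Nat.pow_log_le_self 2 (by omega)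
  have hrn : 2 * (L + 1) + 1 ≤ n := by
    rcases eq_or_lt_of_le hL3 with h | h
    · omega
    · have := two_mul_add_three_le_two_pow (L := L) (by omega)
      omega
  -- the two bad sets
  obtain ⟨Bad, hBad, hgenBad⟩ := exists_affBad (n := n) (by rw [← hLdef]; exact hrn)
  set t := L + 4 with ht
  have htn : t + 2 ≤ n := by have := log_two_add_six_le hn9; omega
  have hpow2 : 4 ≤ 2 ^ (n - t) := by
    calc (4 : ℕ) = 2 ^ 2 := by norm_num
      _ ≤ 2 ^ (n - t) := Nat.pow_le_pow_right (by norm_num) (by omega)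
  set S := 2 ^ (n - t) - 2 with hSdef
  have hS : S + 2 = 2 ^ (n - (Nat.log 2 n + 4)) := by rw [← hLdef, ← ht]; omega
  set Easy : Finset ((Fin n → Bool) → Bool) :=
    Finset.univ.filter fun g => circuitSizeOver B2 g ≤ S with hEasy
  have hEasylt : Easy.card < 2 ^ 2 ^ (n - 1) :=
    (card_easy_le_card_code n S).trans_lt (card_code_lt_two_pow_two_pow_pred hn9 hS)
  have hhalf : 2 ^ 2 ^ (n - 1) ≤ 2 ^ (2 ^ n - 1) := by
    apply Nat.pow_le_pow_right (by norm_num)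
    have h2 : 2 ^ n = 2 * 2 ^ (n - 1) := by rw [← pow_succ']; congr 1; omega
    have : 1 ≤ 2 ^ (n - 1) := Nat.one_le_two_pow
    omega
  have h2n : 1 ≤ 2 ^ n := Nat.one_le_two_pow
  have huniv : (Finset.univ : Finset ((Fin n → Bool) → Bool)).card = 2 ^ (2 ^ n) := by
    simp [Finset.card_univ, Fintype.card_bool, Fintype.card_fin]
  have hunion : (Easy ∪ Bad).card < (Finset.univ : Finset ((Fin n → Bool) → Bool)).card := by
    rw [huniv]
    calc (Easy ∪ Bad).card ≤ Easy.card + Bad.card := Finset.card_union_le _ _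
      _ < 2 ^ (2 ^ n - 1) + 2 ^ (2 ^ n - 1) := by omega
      _ = 2 ^ (2 ^ n) := by rw [← two_mul, ← pow_succ']; congr 1; omega
  obtain ⟨g, -, hg⟩ := Finset.exists_mem_notMem_of_card_lt_card hunion
  rw [Finset.mem_union, not_or] at hg
  have hlt : S < circuitSizeOver B2 g := by
    have := hg.1
    simp only [hEasy, Finset.mem_filter, Finset.mem_univ, true_and, not_le] at this
    exact this
  -- `g` is not constant: constants have circuits of size `1 ≤ S`
  have hS2 : 2 ≤ S := by omega
  have hne : (∃ a, g a = true) ∧ ∃ b, g b = false := by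
    by_contra hcon
    have hconst : ∃ b : Bool, g = fun _ => b := by
      by_cases h1 : ∃ a, g a = true
      · refine ⟨true, funext fun x => ?_⟩
        by_contra hx
        exact hcon ⟨h1, x, by simpa using hx⟩
      · refine ⟨false, funext fun x => ?_⟩
        by_contra hx
        exact h1 ⟨x, by simpa using hx⟩
    obtain ⟨b, hb⟩ := hconst
    have h1 : circuitSizeOver B2 g ≤ 1 := by rw [hb]; exact circuitSizeOver_B2_const_le _ b
    omega
  refine ⟨g, ?_, hgenBad g hg.2, fun P hP => ?_⟩
  · obtain ⟨⟨a, ha⟩, ⟨b, hb⟩⟩ := hne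
    exact ⟨a, b, ha, hb⟩
  · have hdepth := P.circuitSizeOver_B2_lt_two_pow_of_solves hP hne.1 hne.2
    have hle : 2 ^ (n - t) ≤ 2 ^ (P.depth + 1) := by omega
    have hnt : n - t ≤ P.depth + 1 := (Nat.pow_le_pow_iff_right (by norm_num)).mp hle
    omega

end JointExistence

end Summit.PneNP.PneNP.Theorems.KrwLrad
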